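/-
Copyright (c) 2026 the pub-hodgecm-mathlib formalisation cell (harness21).  Prover seat hodgecm-mathlib-F0P2-p10 (g2), Track B «K2-LIT»,
#184♮ = hLiu418 = `stmt-HodgeConjecture-24832`; socket #41, KIND 1, K1-b♮ uniformity bricks (Q2), brick (ρ2) (LEAD F0P6-plan (g14) BATCH #132 (2) 2026-09-04T23:17:58Z;
line lead K2Liu-p14 (g4) LINE WORD #6 «(ρ2) cell function of the middle cell is right-`hK(c)h⁻¹ ∩ N_Δ(𝔸_f)`-invariant (S, group algebra)»).
THEOREMS ONLY (no `def`, no `instance`, no notation, no named-fact hypothesis, no `sorry`).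
-/
import Literature.NumberTheory.GelbartRogawski1991.DoubledUnitaryGlobalSplittingData   -- ★ `HA` = `H(𝔸)` of the doubled hermitian datum
import HarnessLib

/-!
# Crux `HLiu418`, socket #41, KIND 1, (Q2) brick (ρ2) — `K2LiuMiddleCellFunctionRightInvariant`: A CELL FUNCTION `u ↦ Σ_γ f(γ · u · h)` OF A RIGHT-`K`-INVARIANT `f`
# IS RIGHT-INVARIANT UNDER `h K h⁻¹`

Cell `hodgecm-mathlib`, crux item hLiu418 = `stmt-HodgeConjecture-24832` (route of record `HCCMUnconditional`); squad K2 ∕ K2Liu, road `K2_Liu`, socket #41, KIND 1,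
K1-b♮ line term, uniformity question (Q2); line lead K2Liu-p14 (g4) LINE WORD #6 (2026-09-04T23:16:50Z): «the middle-cell term is the `S`-Fourier coefficient along
`N_Δ(L⁺)∖N_Δ(𝔸)` of the CELL FUNCTION `u ↦ Σ_{γ ∈ P w₀ P} f_s(γ u h)`, which is right-invariant under every `n(b₀) ∈ N_Δ(𝔸_f) ∩ h K(c) h⁻¹` (`f_s` right-`K(c)`-invariant)
⇒ `MID_S(f_s)(h) = ψ_S(n(b₀))·MID_S(f_s)(h)` ⇒ …»; K1 desk F0P2-p11 (g2).  THIS FILE is the GROUP ALGEBRA of that sentence, stated once abstractly (any group `G`, any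
subgroup `K ≤ G`, any right-`K`-invariant `f : G → β`) and once in the tree's adelic currency `G := HA L e dV hdV dW hdW = H(𝔸)` for TERMS, FINITE SUMS and `tsum`s over
any index family `γ : ι → H(𝔸)` (the consumer instantiates `ι :=` the middle cosets `P_Δ(L⁺)∖P_Δ w P_Δ(L⁺)` with their ★ representatives, `K :=` its level
subgroup `K(c)`, `b := n(b₀)`): **`f (γ · (u·b) · h) = f (γ · u · h)` whenever `h⁻¹ b h ∈ K`** — `γ (u b) h = (γ u h) · (h⁻¹ b h)`.  No measure, no character, no
cell structure is used: the intersection with `N_Δ(𝔸_f)` in the line lead's sentence only restricts WHICH `b` the consumer feeds in.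
THEOREMS ONLY; lane `--supports stmt-HodgeConjecture-24832 --as helper` (count-neutral).
* §1 (abstract) `apply_mul_conj_mul_eq` (one term), `cellTerm_rightInvariant` (`u ↦ f (γ u h)`), `sum_cellTerm_rightInvariant` (Finset sums),
  `tsum_cellTerm_rightInvariant` (`∑'`), `finsum_cellTerm_rightInvariant` (`∑ᶠ`), and the subgroup form `cellFunction_rightInvariant_of_mem_conj`
  (`b ∈ h K h⁻¹` stated as `∃ k ∈ K, b = h k h⁻¹`).
* §2 (adelic currency) `cellFunction_rightInvariant_HA`, `tsum_cellFunction_rightInvariant_HA` — the same over `H(𝔸) = HA L e dV hdV dW hdW`.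
[GelbartPiatetskishapiroRallis1987, Part A §2], [KudlaRallis1994, §2], [MoeglinWaldspurger1995, II.1.7].
HONEST LABEL.  Count-neutral helper, closes no socket: `HC_CM` is proved only modulo the 7 printed citations (2 remaining named inputs: hLiu418 =
`stmt-HodgeConjecture-24832`, h413 = `stmt-HodgeConjecture-24833`) until rung 0 closes.

## References
* [GelbartPiatetskishapiroRallis1987] S. Gelbart, I. Piatetski-Shapiro, S. Rallis, *Explicit constructions of automorphic L-functions*, LNM 1254 (1987), Part A §2.
* [KudlaRallis1994] S. S. Kudla, S. Rallis, *A regularized Siegel–Weil formula: the first term identity*, Ann. of Math. 140 (1994), §2.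
* [MoeglinWaldspurger1995] C. Mœglin, J.-L. Waldspurger, *Spectral decomposition and Eisenstein series*, CUP (1995), II.1.7.
-/

set_option autoImplicit false
set_option linter.dupNamespace false -- the mandated namespace repeats `HodgeConjecture.HodgeConjecture`

noncomputable section

open scoped Topology
open NumberField
open Literature.NumberTheory.GelbartRogawski1991 Literature.NumberTheory.GelbartRogawski1991.GRConstruction

namespace Summit.HodgeConjecture.HodgeConjecture.Cruxes.HLiu418.K2LiuMiddleCellFunctionRightInvariant

/-! ## §1 The group algebra: `γ (u b) h = (γ u h)(h⁻¹ b h)` -/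

section Abstract

variable {G : Type*} [Group G] {β : Type*}

/-- the one identity behind everything: `γ · (u · b) · h = (γ · u · h) · (h⁻¹ · b · h)`. [cite: GelbartPiatetskishapiroRallis1987, Part A §2] -/
theorem mul_mul_mul_eq_mul_conj (γ u b h : G) : γ * (u * b) * h = γ * u * h * (h⁻¹ * b * h) := by
  group

/-- **one term**: a right-`K`-invariant `f` satisfies `f (γ (u b) h) = f (γ u h)` whenever `h⁻¹ b h ∈ K`. [cite: GelbartPiatetskishapiroRallis1987, Part A §2] [cite: MoeglinWaldspurger1995, II.1.7] -/
theorem apply_mul_conj_mul_eq {K : Subgroup G} {f : G → β} (hf : ∀ (x : G) (k : G), k ∈ K → f (x * k) = f x)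
    (γ u h : G) {b : G} (hb : h⁻¹ * b * h ∈ K) :
    f (γ * (u * b) * h) = f (γ * u * h) := by
  rw [mul_mul_mul_eq_mul_conj]
  exact hf _ _ hb

/-- **the cell term `u ↦ f (γ u h)` is right-invariant under `h K h⁻¹`** (as a function). [cite: GelbartPiatetskishapiroRallis1987, Part A §2] [cite: MoeglinWaldspurger1995, II.1.7] -/
theorem cellTerm_rightInvariant {K : Subgroup G} {f : G → β} (hf : ∀ (x : G) (k : G), k ∈ K → f (x * k) = f x)
    (γ h : G) {b : G} (hb : h⁻¹ * b * h ∈ K) :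
    (fun u => f (γ * (u * b) * h)) = fun u => f (γ * u * h) :=
  funext fun u => apply_mul_conj_mul_eq hf γ u h hb

/-- `b ∈ h K h⁻¹` in the form the consumer meets it: `b = h k h⁻¹` with `k ∈ K` gives `h⁻¹ b h = k ∈ K`. [cite: GelbartPiatetskishapiroRallis1987, Part A §2] -/
theorem conj_mem_of_eq_conj {K : Subgroup G} {h b k : G} (hk : k ∈ K) (hbk : b = h * k * h⁻¹) : h⁻¹ * b * h ∈ K := by
  have : h⁻¹ * b * h = k := by rw [hbk]; group
  rwa [this]

/-- **finite cell sums**: `Σ_{i ∈ I} c_i · f (γ_i (u b) h) = Σ_{i ∈ I} c_i · f (γ_i u h)` (any coefficients `c`, e.g. `1`). [cite: GelbartPiatetskishapiroRallis1987, Part A §2] [cite: KudlaRallis1994, §2] -/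
theorem sum_cellTerm_rightInvariant [AddCommMonoid β] {R : Type*} [SMul R β] {K : Subgroup G} {f : G → β}
    (hf : ∀ (x : G) (k : G), k ∈ K → f (x * k) = f x) {ι : Type*} (I : Finset ι) (c : ι → R) (γ : ι → G) (u h : G) {b : G} (hb : h⁻¹ * b * h ∈ K) :
    (∑ i ∈ I, c i • f (γ i * (u * b) * h)) = ∑ i ∈ I, c i • f (γ i * u * h) :=
  Finset.sum_congr rfl fun i _ => by rw [apply_mul_conj_mul_eq hf (γ i) u h hb]

/-- **cell functions as `tsum`s** (the shape of the tree's coset sums `Σ' q, …`): `Σ' i, f (γ_i (u b) h) = Σ' i, f (γ_i u h)`. [cite: GelbartPiatetskishapiroRallis1987, Part A §2] [cite: KudlaRallis1994, §2] -/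
theorem tsum_cellTerm_rightInvariant [AddCommMonoid β] [TopologicalSpace β] {K : Subgroup G} {f : G → β}
    (hf : ∀ (x : G) (k : G), k ∈ K → f (x * k) = f x) {ι : Type*} (γ : ι → G) (u h : G) {b : G} (hb : h⁻¹ * b * h ∈ K) :
    (∑' i, f (γ i * (u * b) * h)) = ∑' i, f (γ i * u * h) :=
  tsum_congr fun i => apply_mul_conj_mul_eq hf (γ i) u h hb

/-- **cell functions as `finsum`s**: `Σᶠ i, f (γ_i (u b) h) = Σᶠ i, f (γ_i u h)`. [cite: GelbartPiatetskishapiroRallis1987, Part A §2] [cite: KudlaRallis1994, §2] -/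
theorem finsum_cellTerm_rightInvariant [AddCommMonoid β] {K : Subgroup G} {f : G → β}
    (hf : ∀ (x : G) (k : G), k ∈ K → f (x * k) = f x) {ι : Type*} (γ : ι → G) (u h : G) {b : G} (hb : h⁻¹ * b * h ∈ K) :
    (∑ᶠ i, f (γ i * (u * b) * h)) = ∑ᶠ i, f (γ i * u * h) :=
  finsum_congr fun i => apply_mul_conj_mul_eq hf (γ i) u h hb

/-- **the cell function is right-`hKh⁻¹`-invariant** (subgroup form, `tsum` shape): for `k ∈ K`, `u ↦ Σ' i, f (γ_i u h)` takes the same value at `u` and `u · (h k h⁻¹)`.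
[cite: GelbartPiatetskishapiroRallis1987, Part A §2] [cite: MoeglinWaldspurger1995, II.1.7] -/
theorem cellFunction_rightInvariant_of_mem_conj [AddCommMonoid β] [TopologicalSpace β] {K : Subgroup G} {f : G → β}
    (hf : ∀ (x : G) (k : G), k ∈ K → f (x * k) = f x) {ι : Type*} (γ : ι → G) (h : G) {k : G} (hk : k ∈ K) (u : G) :
    (∑' i, f (γ i * (u * (h * k * h⁻¹)) * h)) = ∑' i, f (γ i * u * h) :=
  tsum_cellTerm_rightInvariant hf γ u h (conj_mem_of_eq_conj hk rfl)

/-- the same invariance for WEIGHTED terms `u ↦ w(u) · f(γ u h)` with a right-`b`-invariant weight `w` (the consumer's `conj ψ_S(u)`-free bookkeeping lives outside; this is the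
form with an extra `u`-dependent factor that is itself `b`-invariant, e.g. a covering weight pulled back from `N_Δ(L⁺)∖N_Δ(𝔸)`). [cite: KudlaRallis1994, §2] -/
theorem tsum_weighted_cellTerm_rightInvariant [TopologicalSpace β] [NonUnitalNonAssocSemiring β] {K : Subgroup G} {f : G → β}
    (hf : ∀ (x : G) (k : G), k ∈ K → f (x * k) = f x) {ι : Type*} (γ : ι → G) (w : ι → G → β) (u h : G) {b : G} (hb : h⁻¹ * b * h ∈ K)
    (hw : ∀ i, w i (u * b) = w i u) :
    (∑' i, w i (u * b) * f (γ i * (u * b) * h)) = ∑' i, w i u * f (γ i * u * h) :=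
  tsum_congr fun i => by rw [hw i, apply_mul_conj_mul_eq hf (γ i) u h hb]

end Abstract

/-! ## §2 The adelic currency `H(𝔸) = HA L e dV hdV dW hdW` -/

section Adelic

variable (L : Type) [Field L] [NumberField L] [IsCMField L]
variable {N M n : ℕ} (e : Fin N × Fin M ≃ Fin n) (dV : Fin N → L) (hdV : ∀ i, IsCMField.complexConj L (dV i) = dV i)
  (dW : Fin M → L) (hdW : ∀ i, IsCMField.complexConj L (dW i) = dW i)

/-- **(ρ2) in the tree's letters, one term**: for a right-`K`-invariant `f : H(𝔸) → ℂ` (`K ≤ H(𝔸)` any subgroup — the consumer's level subgroup `K(c)`), `γ, u, h ∈ H(𝔸)` and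
`b ∈ H(𝔸)` with `h⁻¹ b h ∈ K` (i.e. `b ∈ h K h⁻¹`; the line lead's `b = n(b₀) ∈ N_Δ(𝔸_f) ∩ h K(c) h⁻¹`): `f (γ (u b) h) = f (γ u h)`.
[cite: GelbartPiatetskishapiroRallis1987, Part A §2] [cite: MoeglinWaldspurger1995, II.1.7] -/
theorem cellFunction_rightInvariant_HA {K : Subgroup (HA L e dV hdV dW hdW)} {f : HA L e dV hdV dW hdW → ℂ}
    (hf : ∀ (x k : HA L e dV hdV dW hdW), k ∈ K → f (x * k) = f x) (γ u h : HA L e dV hdV dW hdW) {b : HA L e dV hdV dW hdW}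
    (hb : h⁻¹ * b * h ∈ K) :
    f (γ * (u * b) * h) = f (γ * u * h) :=
  apply_mul_conj_mul_eq hf γ u h hb

/-- **(ρ2) in the tree's letters, the cell function**: `Σ' q, f (γ_q (u b) h) = Σ' q, f (γ_q u h)` for any index family `γ : ι → H(𝔸)` (the consumer's middle cosets
`q ∈ P_Δ(L⁺)∖P_Δ w P_Δ(L⁺)` with representatives `γ_q`), `f` right-`K`-invariant, `h⁻¹ b h ∈ K`. [cite: GelbartPiatetskishapiroRallis1987, Part A §2] [cite: KudlaRallis1994, §2] -/
theorem tsum_cellFunction_rightInvariant_HA {K : Subgroup (HA L e dV hdV dW hdW)} {f : HA L e dV hdV dW hdW → ℂ}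
    (hf : ∀ (x k : HA L e dV hdV dW hdW), k ∈ K → f (x * k) = f x) {ι : Type*} (γ : ι → HA L e dV hdV dW hdW) (u h : HA L e dV hdV dW hdW)
    {b : HA L e dV hdV dW hdW} (hb : h⁻¹ * b * h ∈ K) :
    (∑' q, f (γ q * (u * b) * h)) = ∑' q, f (γ q * u * h) :=
  tsum_cellTerm_rightInvariant hf γ u h hb

/-- … and for a FAMILY `f_s` (the Siegel section in `s`): the invariance holds for every `s` at once. [cite: GelbartPiatetskishapiroRallis1987, Part A §2] [cite: KudlaRallis1994, §2] -/
theorem tsum_cellFunction_family_rightInvariant_HA {K : Subgroup (HA L e dV hdV dW hdW)} {f : ℂ → HA L e dV hdV dW hdW → ℂ}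
    (hf : ∀ (s : ℂ) (x k : HA L e dV hdV dW hdW), k ∈ K → f s (x * k) = f s x) {ι : Type*} (γ : ι → HA L e dV hdV dW hdW)
    (u h : HA L e dV hdV dW hdW) {b : HA L e dV hdV dW hdW} (hb : h⁻¹ * b * h ∈ K) (s : ℂ) :
    (∑' q, f s (γ q * (u * b) * h)) = ∑' q, f s (γ q * u * h) :=
  tsum_cellTerm_rightInvariant (hf s) γ u h hb

end Adelic

end Summit.HodgeConjecture.HodgeConjecture.Cruxes.HLiu418.K2LiuMiddleCellFunctionRightInvariant

end
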